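import Summits.HodgeConjecture.HodgeConjecture.Theorems.Ring2WeilCoverageNormCriteria
import Summits.HodgeConjecture.HodgeConjecture.Theorems.Ring2WeilNormObstructionDescentCensus
import Summits.HodgeConjecture.HodgeConjecture.Theorems.Ring2AbelianAllNonsplitNormObstruction
import HarnessLib

/-!
# Weil-type family coverage — TYPE-III WINDOWS, part Uc (census block b04.29): the Weil rows `W4.d.a` of the curves of Jacobian-carried Weil-type fourfolds — the SECOND SUPPLY (symmetric curves inside the five- and six-point families, THEOREM S31.5) (THEOREMS-S31)

research route conditional on HC_CM; not a corollary; Q11.4-sentence-2 already refuted in dim ≥ 3.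

Ring 2, WEIL-TYPE FAMILY-COVERAGE CENSUS (`HOME/WEIL-FAMILY-COVERAGE.md` `## b04`, block b04.29, owner ring2-b04, gen 66).  SETTING (informal, NOT
formalised; THEOREMS-S30/S31 of the census): each of the 127 singly-symmetric four-point families of `G`-curves (`G = SL₂(5), SL₂(7), SL₂(9)`,
rational quaternionic carrier `χ`, `D`-rank 4) is a one-parameter family of `Σ`-curves `C_t → ℙ¹/μ` (`Σ = G:⟨x⟩`, four-point `Σ`-datum
`(z₁, z₂, x₁, x₂)`), and the `χ̃`-hidden factor of `C_t` (`χ̃` the extension character, `K = ℚ(χ̃)` imaginary quadratic, Schur index one) is a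
Weil-type abelian FOURFOLD `A_t` over `K` of signature `(2,2)` with `B_t ∼ A_t²`.  Ring2-b02's THEOREM X (census b02.21: `a_B ≡ ∏ disc_c · |∏ δ_c|`
modulo `Nm(Kˣ)`) and the literal Gram determinant of the cup form in the (P1)-model `Z/R` were evaluated EXACTLY over `K` by the census engine
`xrow66.py` for all 127 families (THEOREMS-S31: the two legs agree 127/127, `K`-signature `(2,2)` 127/127).  THIS FILE pins the norm-class
arithmetic of the literal numbers of one representative family per (row, carrier): the THEOREM-X value `a_X` and the direct Gram determinant `d`
lie in the class `[a]` of `ℚˣ/Nm(Kˣ)` (`VanGeemen1994.weilNormResidueGroup`), witnessed by explicit solutions of `x² + q·y² = ·`, and that class is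
(resp. is not) the split class `Ring2.Hypotheses.splitDiscriminantClass 2 q` — by the cell's ALREADY-LANDED non-split certificates
(`Ring2WeilNormObstructionDescentCensus`, `Ring2AbelianAllNonsplitNormObstruction`), which are not restated.  Rows met in this part: one second-supply representative (a `Σ`-datum `(z₁,z₂,y₁,y₂)` with a coset class of order > 2, i.e. a symmetric curve inside a five- or six-point `G`-family) per (row, carrier): W4.1.1, W4.2.1, W4.2.5, W4.3.1, W4.3.2, W4.3.5, W4.3.10
(the other field(s) in the companion part).  The signatures, THEOREM X and the (P1)-model are computations / structure theorems of the census, not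
kernel facts; nothing here is a statement about Hodge classes; `HC_CM` is used nowhere.

References: [cite: vanGeemen1994HodgeAV, 5.2 and (5.4.1)].
-/

noncomputable section

set_option linter.dupNamespace false

open Literature.AlgebraicGeometry.Motives
open Literature.AlgebraicGeometry.VanGeemen1994
open Summit.HodgeConjecture.HodgeConjecture.Ring2.Hypotheses
open Summit.HodgeConjecture.Ring2WeilNormDescent

namespace Summit.HodgeConjecture.HodgeConjecture.Ring2.WeilCoverage.SigmaDataWeilRowsC

/-- **2I χ₄, second-supply `Σ`-datum `(2_8,3_6,x2_9,x20_11)` with `G`-branch points 5 (genus 75; `Σ = SL2(5):2[1,h=1]`, `Σ`-datum classes `2_8,3_6,x2_9,x20_11`; `K = ℚ(i)`): the THEOREM-X value `a_X = ∏ disc_c · |∏ δ_c| = 2147483648/135 · 192 = 137438953472/45` has class `[1]` in `ℚˣ/Nm(Kˣ)`** — `(137438953472/45)⁻¹ · 1 = 45/137438953472 = x² + 1·y²` with `x = 3/524288`, `y = 9/524288`.  Row **W4.1.1**.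
research route conditional on HC_CM; not a corollary; Q11.4-sentence-2 already refuted in dim ≥ 3. [cite: vanGeemen1994HodgeAV, (5.4.1)] -/
theorem twoI_chi4_sym_2_8_3_6_x2_9_x20_11_b5_theoremX_mk_eq :
    (QuotientGroup.mk (Units.mk0 ((137438953472 : ℚ) / 45) (by norm_num)) : weilNormResidueGroup 1) =
      QuotientGroup.mk (Units.mk0 (1 : ℚ) (by norm_num)) := by
  rw [QuotientGroup.eq]
  have e : (Units.mk0 ((137438953472 : ℚ) / 45) (by norm_num))⁻¹ * Units.mk0 (1 : ℚ) (by norm_num) =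
      Units.mk0 ((45 : ℚ) / 137438953472) (by norm_num) := Units.ext (by norm_num)
  rw [e]
  exact mem_normUnitsSubgroup_of_sq_add_mul_sq _ (3 / 524288 : ℚ) (9 / 524288 : ℚ) (by norm_num)

/-- **2I χ₄, second-supply `Σ`-datum `(2_8,3_6,x2_9,x20_11)` with `G`-branch points 5 (genus 75; `Σ = SL2(5):2[1,h=1]`, `Σ`-datum classes `2_8,3_6,x2_9,x20_11`; `K = ℚ(i)`): the absolute value `4096/5` of the literal Gram determinant `4096/5` of the cup form on `Z/R` ((P1)-model, `K`-dimension 4, `K`-signature (2,2)) has class `[1]` in `ℚˣ/Nm(Kˣ)`** — `(4096/5)⁻¹ · 1 = 5/4096 = x² + 1·y²` with `x = 1/32`, `y = 1/64`.  Row **W4.1.1**.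
research route conditional on HC_CM; not a corollary; Q11.4-sentence-2 already refuted in dim ≥ 3. [cite: vanGeemen1994HodgeAV, (5.4.1)] -/
theorem twoI_chi4_sym_2_8_3_6_x2_9_x20_11_b5_gram_mk_eq :
    (QuotientGroup.mk (Units.mk0 ((4096 : ℚ) / 5) (by norm_num)) : weilNormResidueGroup 1) =
      QuotientGroup.mk (Units.mk0 (1 : ℚ) (by norm_num)) := by
  rw [QuotientGroup.eq]
  have e : (Units.mk0 ((4096 : ℚ) / 5) (by norm_num))⁻¹ * Units.mk0 (1 : ℚ) (by norm_num) =
      Units.mk0 ((5 : ℚ) / 4096) (by norm_num) := Units.ext (by norm_num)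
  rw [e]
  exact mem_normUnitsSubgroup_of_sq_add_mul_sq _ (1 / 32 : ℚ) (1 / 64 : ℚ) (by norm_num)

/-- **… hence the component carrying `A_t` of this family is the SPLIT one: `[4096/5] = splitDiscriminantClass 2 1`** (`n = 2` even: split iff a norm; `4096/5 = x² + 1·y²`, `x = 128/5`, `y = 64/5`).  Row W4.1.1.
research route conditional on HC_CM; not a corollary; Q11.4-sentence-2 already refuted in dim ≥ 3. [cite: vanGeemen1994HodgeAV, (5.4.1)] -/
theorem twoI_chi4_sym_2_8_3_6_x2_9_x20_11_b5_gram_eq_split :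
    (QuotientGroup.mk (Units.mk0 ((4096 : ℚ) / 5) (by norm_num)) : weilNormResidueGroup 1) = splitDiscriminantClass 2 1 :=
  (mk_eq_splitDiscriminantClass_iff_of_even (by decide) _).2
    (mem_normUnitsSubgroup_of_sq_add_mul_sq _ (128 / 5 : ℚ) (64 / 5 : ℚ) (by norm_num))

/-- **2.A₆ η, second-supply `Σ`-datum `(3_2,5_10,x2_13,x12_14)` with `G`-branch points 5 (genus 637; `Σ = SL2(9):2[1,h=3]`, `Σ`-datum classes `3_2,5_10,x2_13,x12_14`; `K = ℚ(i)`): the THEOREM-X value `a_X = ∏ disc_c · |∏ δ_c| = 3/64 · 120 = 45/8` has class `[1]` in `ℚˣ/Nm(Kˣ)`** — `(45/8)⁻¹ · 1 = 8/45 = x² + 1·y²` with `x = 2/15`, `y = 2/5`.  Row **W4.1.1**.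
research route conditional on HC_CM; not a corollary; Q11.4-sentence-2 already refuted in dim ≥ 3. [cite: vanGeemen1994HodgeAV, (5.4.1)] -/
theorem twoA6_eta_sym_3_2_5_10_x2_13_x12_14_b5_theoremX_mk_eq :
    (QuotientGroup.mk (Units.mk0 ((45 : ℚ) / 8) (by norm_num)) : weilNormResidueGroup 1) =
      QuotientGroup.mk (Units.mk0 (1 : ℚ) (by norm_num)) := by
  rw [QuotientGroup.eq]
  have e : (Units.mk0 ((45 : ℚ) / 8) (by norm_num))⁻¹ * Units.mk0 (1 : ℚ) (by norm_num) =
      Units.mk0 ((8 : ℚ) / 45) (by norm_num) := Units.ext (by norm_num)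
  rw [e]
  exact mem_normUnitsSubgroup_of_sq_add_mul_sq _ (2 / 15 : ℚ) (2 / 5 : ℚ) (by norm_num)

/-- **2.A₆ η, second-supply `Σ`-datum `(3_2,5_10,x2_13,x12_14)` with `G`-branch points 5 (genus 637; `Σ = SL2(9):2[1,h=3]`, `Σ`-datum classes `3_2,5_10,x2_13,x12_14`; `K = ℚ(i)`): the absolute value `4/5` of the literal Gram determinant `4/5` of the cup form on `Z/R` ((P1)-model, `K`-dimension 4, `K`-signature (2,2)) has class `[1]` in `ℚˣ/Nm(Kˣ)`** — `(4/5)⁻¹ · 1 = 5/4 = x² + 1·y²` with `x = 1`, `y = 1/2`.  Row **W4.1.1**.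
research route conditional on HC_CM; not a corollary; Q11.4-sentence-2 already refuted in dim ≥ 3. [cite: vanGeemen1994HodgeAV, (5.4.1)] -/
theorem twoA6_eta_sym_3_2_5_10_x2_13_x12_14_b5_gram_mk_eq :
    (QuotientGroup.mk (Units.mk0 ((4 : ℚ) / 5) (by norm_num)) : weilNormResidueGroup 1) =
      QuotientGroup.mk (Units.mk0 (1 : ℚ) (by norm_num)) := by
  rw [QuotientGroup.eq]
  have e : (Units.mk0 ((4 : ℚ) / 5) (by norm_num))⁻¹ * Units.mk0 (1 : ℚ) (by norm_num) =
      Units.mk0 ((5 : ℚ) / 4) (by norm_num) := Units.ext (by norm_num)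
  rw [e]
  exact mem_normUnitsSubgroup_of_sq_add_mul_sq _ (1 : ℚ) (1 / 2 : ℚ) (by norm_num)

/-- **… hence the component carrying `A_t` of this family is the SPLIT one: `[4/5] = splitDiscriminantClass 2 1`** (`n = 2` even: split iff a norm; `4/5 = x² + 1·y²`, `x = 4/5`, `y = 2/5`).  Row W4.1.1.
research route conditional on HC_CM; not a corollary; Q11.4-sentence-2 already refuted in dim ≥ 3. [cite: vanGeemen1994HodgeAV, (5.4.1)] -/
theorem twoA6_eta_sym_3_2_5_10_x2_13_x12_14_b5_gram_eq_split :
    (QuotientGroup.mk (Units.mk0 ((4 : ℚ) / 5) (by norm_num)) : weilNormResidueGroup 1) = splitDiscriminantClass 2 1 :=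
  (mk_eq_splitDiscriminantClass_iff_of_even (by decide) _).2
    (mem_normUnitsSubgroup_of_sq_add_mul_sq _ (4 / 5 : ℚ) (2 / 5 : ℚ) (by norm_num))

/-- **2I χ₆, second-supply `Σ`-datum `(5_2,3_6,x2_7,x6_10)` with `G`-branch points 5 (genus 97; `Σ = SL2(5):2[delta,h=3]`, `Σ`-datum classes `5_2,3_6,x2_7,x6_10`; `K = ℚ(√-2)`): the THEOREM-X value `a_X = ∏ disc_c · |∏ δ_c| = 2182269365241555791485443/4000000000 · 2160 = 58921272861522006370106961/50000000` has class `[1]` in `ℚˣ/Nm(Kˣ)`** — `(58921272861522006370106961/50000000)⁻¹ · 1 = 50000000/58921272861522006370106961 = x² + 2·y²` with `x = 0`, `y = 5000/7676019336969`.  Row **W4.2.1**.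
research route conditional on HC_CM; not a corollary; Q11.4-sentence-2 already refuted in dim ≥ 3. [cite: vanGeemen1994HodgeAV, (5.4.1)] -/
theorem twoI_chi6_sym_5_2_3_6_x2_7_x6_10_b5_theoremX_mk_eq :
    (QuotientGroup.mk (Units.mk0 ((58921272861522006370106961 : ℚ) / 50000000) (by norm_num)) : weilNormResidueGroup 2) =
      QuotientGroup.mk (Units.mk0 (1 : ℚ) (by norm_num)) := by
  rw [QuotientGroup.eq]
  have e : (Units.mk0 ((58921272861522006370106961 : ℚ) / 50000000) (by norm_num))⁻¹ * Units.mk0 (1 : ℚ) (by norm_num) =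
      Units.mk0 ((50000000 : ℚ) / 58921272861522006370106961) (by norm_num) := Units.ext (by norm_num)
  rw [e]
  exact mem_normUnitsSubgroup_of_sq_add_mul_sq _ (0 : ℚ) (5000 / 7676019336969 : ℚ) (by norm_num)

/-- **2I χ₆, second-supply `Σ`-datum `(5_2,3_6,x2_7,x6_10)` with `G`-branch points 5 (genus 97; `Σ = SL2(5):2[delta,h=3]`, `Σ`-datum classes `5_2,3_6,x2_7,x6_10`; `K = ℚ(√-2)`): the absolute value `17546899/225` of the literal Gram determinant `17546899/225` of the cup form on `Z/R` ((P1)-model, `K`-dimension 4, `K`-signature (2,2)) has class `[1]` in `ℚˣ/Nm(Kˣ)`** — `(17546899/225)⁻¹ · 1 = 225/17546899 = x² + 2·y²` with `x = 15/18259`, `y = 45/18259`.  Row **W4.2.1**.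
research route conditional on HC_CM; not a corollary; Q11.4-sentence-2 already refuted in dim ≥ 3. [cite: vanGeemen1994HodgeAV, (5.4.1)] -/
theorem twoI_chi6_sym_5_2_3_6_x2_7_x6_10_b5_gram_mk_eq :
    (QuotientGroup.mk (Units.mk0 ((17546899 : ℚ) / 225) (by norm_num)) : weilNormResidueGroup 2) =
      QuotientGroup.mk (Units.mk0 (1 : ℚ) (by norm_num)) := by
  rw [QuotientGroup.eq]
  have e : (Units.mk0 ((17546899 : ℚ) / 225) (by norm_num))⁻¹ * Units.mk0 (1 : ℚ) (by norm_num) =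
      Units.mk0 ((225 : ℚ) / 17546899) (by norm_num) := Units.ext (by norm_num)
  rw [e]
  exact mem_normUnitsSubgroup_of_sq_add_mul_sq _ (15 / 18259 : ℚ) (45 / 18259 : ℚ) (by norm_num)

/-- **… hence the component carrying `A_t` of this family is the SPLIT one: `[17546899/225] = splitDiscriminantClass 2 2`** (`n = 2` even: split iff a norm; `17546899/225 = x² + 2·y²`, `x = 961/15`, `y = 961/5`).  Row W4.2.1.
research route conditional on HC_CM; not a corollary; Q11.4-sentence-2 already refuted in dim ≥ 3. [cite: vanGeemen1994HodgeAV, (5.4.1)] -/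
theorem twoI_chi6_sym_5_2_3_6_x2_7_x6_10_b5_gram_eq_split :
    (QuotientGroup.mk (Units.mk0 ((17546899 : ℚ) / 225) (by norm_num)) : weilNormResidueGroup 2) = splitDiscriminantClass 2 2 :=
  (mk_eq_splitDiscriminantClass_iff_of_even (by decide) _).2
    (mem_normUnitsSubgroup_of_sq_add_mul_sq _ (961 / 15 : ℚ) (961 / 5 : ℚ) (by norm_num))

/-- **2I χ₆, second-supply `Σ`-datum `(3_6,3_6,x2_7,x6_10)` with `G`-branch points 5 (genus 81; `Σ = SL2(5):2[delta,h=3]`, `Σ`-datum classes `3_6,3_6,x2_7,x6_10`; `K = ℚ(√-2)`): the THEOREM-X value `a_X = ∏ disc_c · |∏ δ_c| = 19640424287174002123368987/16000000000 · 3888 = 4772623101783282515978663841/1000000000` has class `[5]` in `ℚˣ/Nm(Kˣ)`** — `(4772623101783282515978663841/1000000000)⁻¹ · 5 = 5000000000/4772623101783282515978663841 = x² + 2·y²` with `x = 0`, `y = 50000/69084174032721`.  Row **W4.2.5**.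
research route conditional on HC_CM; not a corollary; Q11.4-sentence-2 already refuted in dim ≥ 3. [cite: vanGeemen1994HodgeAV, (5.4.1)] -/
theorem twoI_chi6_sym_3_6_3_6_x2_7_x6_10_b5_theoremX_mk_eq :
    (QuotientGroup.mk (Units.mk0 ((4772623101783282515978663841 : ℚ) / 1000000000) (by norm_num)) : weilNormResidueGroup 2) =
      QuotientGroup.mk (Units.mk0 (5 : ℚ) (by norm_num)) := by
  rw [QuotientGroup.eq]
  have e : (Units.mk0 ((4772623101783282515978663841 : ℚ) / 1000000000) (by norm_num))⁻¹ * Units.mk0 (5 : ℚ) (by norm_num) =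
      Units.mk0 ((5000000000 : ℚ) / 4772623101783282515978663841) (by norm_num) := Units.ext (by norm_num)
  rw [e]
  exact mem_normUnitsSubgroup_of_sq_add_mul_sq _ (0 : ℚ) (50000 / 69084174032721 : ℚ) (by norm_num)

/-- **2I χ₆, second-supply `Σ`-datum `(3_6,3_6,x2_7,x6_10)` with `G`-branch points 5 (genus 81; `Σ = SL2(5):2[delta,h=3]`, `Σ`-datum classes `3_6,3_6,x2_7,x6_10`; `K = ℚ(√-2)`): the absolute value `17546899/1320` of the literal Gram determinant `17546899/1320` of the cup form on `Z/R` ((P1)-model, `K`-dimension 4, `K`-signature (2,2)) has class `[5]` in `ℚˣ/Nm(Kˣ)`** — `(17546899/1320)⁻¹ · 5 = 6600/17546899 = x² + 2·y²` with `x = 260/18259`, `y = 170/18259`.  Row **W4.2.5**.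
research route conditional on HC_CM; not a corollary; Q11.4-sentence-2 already refuted in dim ≥ 3. [cite: vanGeemen1994HodgeAV, (5.4.1)] -/
theorem twoI_chi6_sym_3_6_3_6_x2_7_x6_10_b5_gram_mk_eq :
    (QuotientGroup.mk (Units.mk0 ((17546899 : ℚ) / 1320) (by norm_num)) : weilNormResidueGroup 2) =
      QuotientGroup.mk (Units.mk0 (5 : ℚ) (by norm_num)) := by
  rw [QuotientGroup.eq]
  have e : (Units.mk0 ((17546899 : ℚ) / 1320) (by norm_num))⁻¹ * Units.mk0 (5 : ℚ) (by norm_num) =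
      Units.mk0 ((6600 : ℚ) / 17546899) (by norm_num) := Units.ext (by norm_num)
  rw [e]
  exact mem_normUnitsSubgroup_of_sq_add_mul_sq _ (260 / 18259 : ℚ) (170 / 18259 : ℚ) (by norm_num)

/-- **… hence the component carrying `A_t` of this family is NOT the split one: `[17546899/1320] = [5] ≠ splitDiscriminantClass 2 2`** (by the cell's landed non-split certificate for `(ℚ(√-2), a = 5)`, not restated).  Row W4.2.5.
research route conditional on HC_CM; not a corollary; Q11.4-sentence-2 already refuted in dim ≥ 3. [cite: vanGeemen1994HodgeAV, (5.4.1)] -/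
theorem twoI_chi6_sym_3_6_3_6_x2_7_x6_10_b5_gram_ne_split :
    (QuotientGroup.mk (Units.mk0 ((17546899 : ℚ) / 1320) (by norm_num)) : weilNormResidueGroup 2) ≠ splitDiscriminantClass 2 2 := by
  rw [twoI_chi6_sym_3_6_3_6_x2_7_x6_10_b5_gram_mk_eq]
  exact five_ne_split_two_of_even (by decide)

/-- **2I χ₄, second-supply `Σ`-datum `(3_6,10_7,x2_7,x8_8)` with `G`-branch points 5 (genus 114; `Σ = SL2(5):2[delta,h=3]`, `Σ`-datum classes `3_6,10_7,x2_7,x8_8`; `K = ℚ(√-3)`): the THEOREM-X value `a_X = ∏ disc_c · |∏ δ_c| = 1119744/49 · 24 = 26873856/49` has class `[1]` in `ℚˣ/Nm(Kˣ)`** — `(26873856/49)⁻¹ · 1 = 49/26873856 = x² + 3·y²` with `x = 7/5184`, `y = 0`.  Row **W4.3.1**.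
research route conditional on HC_CM; not a corollary; Q11.4-sentence-2 already refuted in dim ≥ 3. [cite: vanGeemen1994HodgeAV, (5.4.1)] -/
theorem twoI_chi4_sym_3_6_10_7_x2_7_x8_8_b5_theoremX_mk_eq :
    (QuotientGroup.mk (Units.mk0 ((26873856 : ℚ) / 49) (by norm_num)) : weilNormResidueGroup 3) =
      QuotientGroup.mk (Units.mk0 (1 : ℚ) (by norm_num)) := by
  rw [QuotientGroup.eq]
  have e : (Units.mk0 ((26873856 : ℚ) / 49) (by norm_num))⁻¹ * Units.mk0 (1 : ℚ) (by norm_num) =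
      Units.mk0 ((49 : ℚ) / 26873856) (by norm_num) := Units.ext (by norm_num)
  rw [e]
  exact mem_normUnitsSubgroup_of_sq_add_mul_sq _ (7 / 5184 : ℚ) (0 : ℚ) (by norm_num)

/-- **2I χ₄, second-supply `Σ`-datum `(3_6,10_7,x2_7,x8_8)` with `G`-branch points 5 (genus 114; `Σ = SL2(5):2[delta,h=3]`, `Σ`-datum classes `3_6,10_7,x2_7,x8_8`; `K = ℚ(√-3)`): the absolute value `192/7` of the literal Gram determinant `192/7` of the cup form on `Z/R` ((P1)-model, `K`-dimension 4, `K`-signature (2,2)) has class `[1]` in `ℚˣ/Nm(Kˣ)`** — `(192/7)⁻¹ · 1 = 7/192 = x² + 3·y²` with `x = 1/8`, `y = 1/12`.  Row **W4.3.1**.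
research route conditional on HC_CM; not a corollary; Q11.4-sentence-2 already refuted in dim ≥ 3. [cite: vanGeemen1994HodgeAV, (5.4.1)] -/
theorem twoI_chi4_sym_3_6_10_7_x2_7_x8_8_b5_gram_mk_eq :
    (QuotientGroup.mk (Units.mk0 ((192 : ℚ) / 7) (by norm_num)) : weilNormResidueGroup 3) =
      QuotientGroup.mk (Units.mk0 (1 : ℚ) (by norm_num)) := by
  rw [QuotientGroup.eq]
  have e : (Units.mk0 ((192 : ℚ) / 7) (by norm_num))⁻¹ * Units.mk0 (1 : ℚ) (by norm_num) =
      Units.mk0 ((7 : ℚ) / 192) (by norm_num) := Units.ext (by norm_num)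
  rw [e]
  exact mem_normUnitsSubgroup_of_sq_add_mul_sq _ (1 / 8 : ℚ) (1 / 12 : ℚ) (by norm_num)

/-- **… hence the component carrying `A_t` of this family is the SPLIT one: `[192/7] = splitDiscriminantClass 2 3`** (`n = 2` even: split iff a norm; `192/7 = x² + 3·y²`, `x = 24/7`, `y = 16/7`).  Row W4.3.1.
research route conditional on HC_CM; not a corollary; Q11.4-sentence-2 already refuted in dim ≥ 3. [cite: vanGeemen1994HodgeAV, (5.4.1)] -/
theorem twoI_chi4_sym_3_6_10_7_x2_7_x8_8_b5_gram_eq_split :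
    (QuotientGroup.mk (Units.mk0 ((192 : ℚ) / 7) (by norm_num)) : weilNormResidueGroup 3) = splitDiscriminantClass 2 3 :=
  (mk_eq_splitDiscriminantClass_iff_of_even (by decide) _).2
    (mem_normUnitsSubgroup_of_sq_add_mul_sq _ (24 / 7 : ℚ) (16 / 7 : ℚ) (by norm_num))

/-- **2.A₆ η, second-supply `Σ`-datum `(3_2,10_8,x2_10,x8_14)` with `G`-branch points 5 (genus 679; `Σ = SL2(9):2[phi,h=0]`, `Σ`-datum classes `3_2,10_8,x2_10,x8_14`; `K = ℚ(√-3)`): the THEOREM-X value `a_X = ∏ disc_c · |∏ δ_c| = 2187/8192 · 24 = 6561/1024` has class `[1]` in `ℚˣ/Nm(Kˣ)`** — `(6561/1024)⁻¹ · 1 = 1024/6561 = x² + 3·y²` with `x = 32/81`, `y = 0`.  Row **W4.3.1**.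
research route conditional on HC_CM; not a corollary; Q11.4-sentence-2 already refuted in dim ≥ 3. [cite: vanGeemen1994HodgeAV, (5.4.1)] -/
theorem twoA6_eta_sym_3_2_10_8_x2_10_x8_14_b5_theoremX_mk_eq :
    (QuotientGroup.mk (Units.mk0 ((6561 : ℚ) / 1024) (by norm_num)) : weilNormResidueGroup 3) =
      QuotientGroup.mk (Units.mk0 (1 : ℚ) (by norm_num)) := by
  rw [QuotientGroup.eq]
  have e : (Units.mk0 ((6561 : ℚ) / 1024) (by norm_num))⁻¹ * Units.mk0 (1 : ℚ) (by norm_num) =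
      Units.mk0 ((1024 : ℚ) / 6561) (by norm_num) := Units.ext (by norm_num)
  rw [e]
  exact mem_normUnitsSubgroup_of_sq_add_mul_sq _ (32 / 81 : ℚ) (0 : ℚ) (by norm_num)

/-- **2.A₆ η, second-supply `Σ`-datum `(3_2,10_8,x2_10,x8_14)` with `G`-branch points 5 (genus 679; `Σ = SL2(9):2[phi,h=0]`, `Σ`-datum classes `3_2,10_8,x2_10,x8_14`; `K = ℚ(√-3)`): the absolute value `9/4` of the literal Gram determinant `9/4` of the cup form on `Z/R` ((P1)-model, `K`-dimension 4, `K`-signature (2,2)) has class `[1]` in `ℚˣ/Nm(Kˣ)`** — `(9/4)⁻¹ · 1 = 4/9 = x² + 3·y²` with `x = 2/3`, `y = 0`.  Row **W4.3.1**.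
research route conditional on HC_CM; not a corollary; Q11.4-sentence-2 already refuted in dim ≥ 3. [cite: vanGeemen1994HodgeAV, (5.4.1)] -/
theorem twoA6_eta_sym_3_2_10_8_x2_10_x8_14_b5_gram_mk_eq :
    (QuotientGroup.mk (Units.mk0 ((9 : ℚ) / 4) (by norm_num)) : weilNormResidueGroup 3) =
      QuotientGroup.mk (Units.mk0 (1 : ℚ) (by norm_num)) := by
  rw [QuotientGroup.eq]
  have e : (Units.mk0 ((9 : ℚ) / 4) (by norm_num))⁻¹ * Units.mk0 (1 : ℚ) (by norm_num) =
      Units.mk0 ((4 : ℚ) / 9) (by norm_num) := Units.ext (by norm_num)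
  rw [e]
  exact mem_normUnitsSubgroup_of_sq_add_mul_sq _ (2 / 3 : ℚ) (0 : ℚ) (by norm_num)

/-- **… hence the component carrying `A_t` of this family is the SPLIT one: `[9/4] = splitDiscriminantClass 2 3`** (`n = 2` even: split iff a norm; `9/4 = x² + 3·y²`, `x = 3/2`, `y = 0`).  Row W4.3.1.
research route conditional on HC_CM; not a corollary; Q11.4-sentence-2 already refuted in dim ≥ 3. [cite: vanGeemen1994HodgeAV, (5.4.1)] -/
theorem twoA6_eta_sym_3_2_10_8_x2_10_x8_14_b5_gram_eq_split :
    (QuotientGroup.mk (Units.mk0 ((9 : ℚ) / 4) (by norm_num)) : weilNormResidueGroup 3) = splitDiscriminantClass 2 3 :=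
  (mk_eq_splitDiscriminantClass_iff_of_even (by decide) _).2
    (mem_normUnitsSubgroup_of_sq_add_mul_sq _ (3 / 2 : ℚ) (0 : ℚ) (by norm_num))

/-- **2.A₆ η, second-supply `Σ`-datum `(8_4,3_2,x2_10,x8_14)` with `G`-branch points 5 (genus 661; `Σ = SL2(9):2[phi,h=0]`, `Σ`-datum classes `8_4,3_2,x2_10,x8_14`; `K = ℚ(√-3)`): the THEOREM-X value `a_X = ∏ disc_c · |∏ δ_c| = 2187/8192 · 48 = 6561/512` has class `[2]` in `ℚˣ/Nm(Kˣ)`** — `(6561/512)⁻¹ · 2 = 1024/6561 = x² + 3·y²` with `x = 32/81`, `y = 0`.  Row **W4.3.2**.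
research route conditional on HC_CM; not a corollary; Q11.4-sentence-2 already refuted in dim ≥ 3. [cite: vanGeemen1994HodgeAV, (5.4.1)] -/
theorem twoA6_eta_sym_8_4_3_2_x2_10_x8_14_b5_theoremX_mk_eq :
    (QuotientGroup.mk (Units.mk0 ((6561 : ℚ) / 512) (by norm_num)) : weilNormResidueGroup 3) =
      QuotientGroup.mk (Units.mk0 (2 : ℚ) (by norm_num)) := by
  rw [QuotientGroup.eq]
  have e : (Units.mk0 ((6561 : ℚ) / 512) (by norm_num))⁻¹ * Units.mk0 (2 : ℚ) (by norm_num) =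
      Units.mk0 ((1024 : ℚ) / 6561) (by norm_num) := Units.ext (by norm_num)
  rw [e]
  exact mem_normUnitsSubgroup_of_sq_add_mul_sq _ (32 / 81 : ℚ) (0 : ℚ) (by norm_num)

/-- **2.A₆ η, second-supply `Σ`-datum `(8_4,3_2,x2_10,x8_14)` with `G`-branch points 5 (genus 661; `Σ = SL2(9):2[phi,h=0]`, `Σ`-datum classes `8_4,3_2,x2_10,x8_14`; `K = ℚ(√-3)`): the absolute value `3/2` of the literal Gram determinant `3/2` of the cup form on `Z/R` ((P1)-model, `K`-dimension 4, `K`-signature (2,2)) has class `[2]` in `ℚˣ/Nm(Kˣ)`** — `(3/2)⁻¹ · 2 = 4/3 = x² + 3·y²` with `x = 0`, `y = 2/3`.  Row **W4.3.2**.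
research route conditional on HC_CM; not a corollary; Q11.4-sentence-2 already refuted in dim ≥ 3. [cite: vanGeemen1994HodgeAV, (5.4.1)] -/
theorem twoA6_eta_sym_8_4_3_2_x2_10_x8_14_b5_gram_mk_eq :
    (QuotientGroup.mk (Units.mk0 ((3 : ℚ) / 2) (by norm_num)) : weilNormResidueGroup 3) =
      QuotientGroup.mk (Units.mk0 (2 : ℚ) (by norm_num)) := by
  rw [QuotientGroup.eq]
  have e : (Units.mk0 ((3 : ℚ) / 2) (by norm_num))⁻¹ * Units.mk0 (2 : ℚ) (by norm_num) =
      Units.mk0 ((4 : ℚ) / 3) (by norm_num) := Units.ext (by norm_num)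
  rw [e]
  exact mem_normUnitsSubgroup_of_sq_add_mul_sq _ (0 : ℚ) (2 / 3 : ℚ) (by norm_num)

/-- **… hence the component carrying `A_t` of this family is NOT the split one: `[3/2] = [2] ≠ splitDiscriminantClass 2 3`** (by the cell's landed non-split certificate for `(ℚ(√-3), a = 2)`, not restated).  Row W4.3.2.
research route conditional on HC_CM; not a corollary; Q11.4-sentence-2 already refuted in dim ≥ 3. [cite: vanGeemen1994HodgeAV, (5.4.1)] -/
theorem twoA6_eta_sym_8_4_3_2_x2_10_x8_14_b5_gram_ne_split :
    (QuotientGroup.mk (Units.mk0 ((3 : ℚ) / 2) (by norm_num)) : weilNormResidueGroup 3) ≠ splitDiscriminantClass 2 3 := by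
  rw [twoA6_eta_sym_8_4_3_2_x2_10_x8_14_b5_gram_mk_eq]
  exact Summit.HodgeConjecture.Ring2AbelianAll.NonsplitNormObstruction.two_ne_splitDiscriminantClass_of_even (by decide)

/-- **2I χ₄, second-supply `Σ`-datum `(5_2,3_6,x2_7,x8_8)` with `G`-branch points 5 (genus 102; `Σ = SL2(5):2[delta,h=3]`, `Σ`-datum classes `5_2,3_6,x2_7,x8_8`; `K = ℚ(√-3)`): the THEOREM-X value `a_X = ∏ disc_c · |∏ δ_c| = 1119744/49 · 120 = 134369280/49` has class `[5]` in `ℚˣ/Nm(Kˣ)`** — `(134369280/49)⁻¹ · 5 = 49/26873856 = x² + 3·y²` with `x = 7/5184`, `y = 0`.  Row **W4.3.5**.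
research route conditional on HC_CM; not a corollary; Q11.4-sentence-2 already refuted in dim ≥ 3. [cite: vanGeemen1994HodgeAV, (5.4.1)] -/
theorem twoI_chi4_sym_5_2_3_6_x2_7_x8_8_b5_theoremX_mk_eq :
    (QuotientGroup.mk (Units.mk0 ((134369280 : ℚ) / 49) (by norm_num)) : weilNormResidueGroup 3) =
      QuotientGroup.mk (Units.mk0 (5 : ℚ) (by norm_num)) := by
  rw [QuotientGroup.eq]
  have e : (Units.mk0 ((134369280 : ℚ) / 49) (by norm_num))⁻¹ * Units.mk0 (5 : ℚ) (by norm_num) =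
      Units.mk0 ((49 : ℚ) / 26873856) (by norm_num) := Units.ext (by norm_num)
  rw [e]
  exact mem_normUnitsSubgroup_of_sq_add_mul_sq _ (7 / 5184 : ℚ) (0 : ℚ) (by norm_num)

/-- **2I χ₄, second-supply `Σ`-datum `(5_2,3_6,x2_7,x8_8)` with `G`-branch points 5 (genus 102; `Σ = SL2(5):2[delta,h=3]`, `Σ`-datum classes `5_2,3_6,x2_7,x8_8`; `K = ℚ(√-3)`): the absolute value `2304/245` of the literal Gram determinant `2304/245` of the cup form on `Z/R` ((P1)-model, `K`-dimension 4, `K`-signature (2,2)) has class `[5]` in `ℚˣ/Nm(Kˣ)`** — `(2304/245)⁻¹ · 5 = 1225/2304 = x² + 3·y²` with `x = 35/48`, `y = 0`.  Row **W4.3.5**.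
research route conditional on HC_CM; not a corollary; Q11.4-sentence-2 already refuted in dim ≥ 3. [cite: vanGeemen1994HodgeAV, (5.4.1)] -/
theorem twoI_chi4_sym_5_2_3_6_x2_7_x8_8_b5_gram_mk_eq :
    (QuotientGroup.mk (Units.mk0 ((2304 : ℚ) / 245) (by norm_num)) : weilNormResidueGroup 3) =
      QuotientGroup.mk (Units.mk0 (5 : ℚ) (by norm_num)) := by
  rw [QuotientGroup.eq]
  have e : (Units.mk0 ((2304 : ℚ) / 245) (by norm_num))⁻¹ * Units.mk0 (5 : ℚ) (by norm_num) =
      Units.mk0 ((1225 : ℚ) / 2304) (by norm_num) := Units.ext (by norm_num)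
  rw [e]
  exact mem_normUnitsSubgroup_of_sq_add_mul_sq _ (35 / 48 : ℚ) (0 : ℚ) (by norm_num)

/-- **… hence the component carrying `A_t` of this family is NOT the split one: `[2304/245] = [5] ≠ splitDiscriminantClass 2 3`** (by the cell's landed non-split certificate for `(ℚ(√-3), a = 5)`, not restated).  Row W4.3.5.
research route conditional on HC_CM; not a corollary; Q11.4-sentence-2 already refuted in dim ≥ 3. [cite: vanGeemen1994HodgeAV, (5.4.1)] -/
theorem twoI_chi4_sym_5_2_3_6_x2_7_x8_8_b5_gram_ne_split :
    (QuotientGroup.mk (Units.mk0 ((2304 : ℚ) / 245) (by norm_num)) : weilNormResidueGroup 3) ≠ splitDiscriminantClass 2 3 := by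
  rw [twoI_chi4_sym_5_2_3_6_x2_7_x8_8_b5_gram_mk_eq]
  exact five_ne_split_three_of_even (by decide)

/-- **2.A₆ η, second-supply `Σ`-datum `(3_2,5_11,x2_10,x8_14)` with `G`-branch points 5 (genus 607; `Σ = SL2(9):2[phi,h=0]`, `Σ`-datum classes `3_2,5_11,x2_10,x8_14`; `K = ℚ(√-3)`): the THEOREM-X value `a_X = ∏ disc_c · |∏ δ_c| = 2187/8192 · 120 = 32805/1024` has class `[5]` in `ℚˣ/Nm(Kˣ)`** — `(32805/1024)⁻¹ · 5 = 1024/6561 = x² + 3·y²` with `x = 32/81`, `y = 0`.  Row **W4.3.5**.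
research route conditional on HC_CM; not a corollary; Q11.4-sentence-2 already refuted in dim ≥ 3. [cite: vanGeemen1994HodgeAV, (5.4.1)] -/
theorem twoA6_eta_sym_3_2_5_11_x2_10_x8_14_b5_theoremX_mk_eq :
    (QuotientGroup.mk (Units.mk0 ((32805 : ℚ) / 1024) (by norm_num)) : weilNormResidueGroup 3) =
      QuotientGroup.mk (Units.mk0 (5 : ℚ) (by norm_num)) := by
  rw [QuotientGroup.eq]
  have e : (Units.mk0 ((32805 : ℚ) / 1024) (by norm_num))⁻¹ * Units.mk0 (5 : ℚ) (by norm_num) =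
      Units.mk0 ((1024 : ℚ) / 6561) (by norm_num) := Units.ext (by norm_num)
  rw [e]
  exact mem_normUnitsSubgroup_of_sq_add_mul_sq _ (32 / 81 : ℚ) (0 : ℚ) (by norm_num)

/-- **2.A₆ η, second-supply `Σ`-datum `(3_2,5_11,x2_10,x8_14)` with `G`-branch points 5 (genus 607; `Σ = SL2(9):2[phi,h=0]`, `Σ`-datum classes `3_2,5_11,x2_10,x8_14`; `K = ℚ(√-3)`): the absolute value `9/20` of the literal Gram determinant `9/20` of the cup form on `Z/R` ((P1)-model, `K`-dimension 4, `K`-signature (2,2)) has class `[5]` in `ℚˣ/Nm(Kˣ)`** — `(9/20)⁻¹ · 5 = 100/9 = x² + 3·y²` with `x = 10/3`, `y = 0`.  Row **W4.3.5**.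
research route conditional on HC_CM; not a corollary; Q11.4-sentence-2 already refuted in dim ≥ 3. [cite: vanGeemen1994HodgeAV, (5.4.1)] -/
theorem twoA6_eta_sym_3_2_5_11_x2_10_x8_14_b5_gram_mk_eq :
    (QuotientGroup.mk (Units.mk0 ((9 : ℚ) / 20) (by norm_num)) : weilNormResidueGroup 3) =
      QuotientGroup.mk (Units.mk0 (5 : ℚ) (by norm_num)) := by
  rw [QuotientGroup.eq]
  have e : (Units.mk0 ((9 : ℚ) / 20) (by norm_num))⁻¹ * Units.mk0 (5 : ℚ) (by norm_num) =
      Units.mk0 ((100 : ℚ) / 9) (by norm_num) := Units.ext (by norm_num)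
  rw [e]
  exact mem_normUnitsSubgroup_of_sq_add_mul_sq _ (10 / 3 : ℚ) (0 : ℚ) (by norm_num)

/-- **… hence the component carrying `A_t` of this family is NOT the split one: `[9/20] = [5] ≠ splitDiscriminantClass 2 3`** (by the cell's landed non-split certificate for `(ℚ(√-3), a = 5)`, not restated).  Row W4.3.5.
research route conditional on HC_CM; not a corollary; Q11.4-sentence-2 already refuted in dim ≥ 3. [cite: vanGeemen1994HodgeAV, (5.4.1)] -/
theorem twoA6_eta_sym_3_2_5_11_x2_10_x8_14_b5_gram_ne_split :
    (QuotientGroup.mk (Units.mk0 ((9 : ℚ) / 20) (by norm_num)) : weilNormResidueGroup 3) ≠ splitDiscriminantClass 2 3 := by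
  rw [twoA6_eta_sym_3_2_5_11_x2_10_x8_14_b5_gram_mk_eq]
  exact five_ne_split_three_of_even (by decide)

/-- **2.A₆ η, second-supply `Σ`-datum `(3_2,5_11,x2_10,x4_11)` with `G`-branch points 5 (genus 517; `Σ = SL2(9):2[phi,h=0]`, `Σ`-datum classes `3_2,5_11,x2_10,x4_11`; `K = ℚ(√-3)`): the THEOREM-X value `a_X = ∏ disc_c · |∏ δ_c| = 2187/8192 · 240 = 32805/512` has class `[10]` in `ℚˣ/Nm(Kˣ)`** — `(32805/512)⁻¹ · 10 = 1024/6561 = x² + 3·y²` with `x = 32/81`, `y = 0`.  Row **W4.3.10**.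
research route conditional on HC_CM; not a corollary; Q11.4-sentence-2 already refuted in dim ≥ 3. [cite: vanGeemen1994HodgeAV, (5.4.1)] -/
theorem twoA6_eta_sym_3_2_5_11_x2_10_x4_11_b5_theoremX_mk_eq :
    (QuotientGroup.mk (Units.mk0 ((32805 : ℚ) / 512) (by norm_num)) : weilNormResidueGroup 3) =
      QuotientGroup.mk (Units.mk0 (10 : ℚ) (by norm_num)) := by
  rw [QuotientGroup.eq]
  have e : (Units.mk0 ((32805 : ℚ) / 512) (by norm_num))⁻¹ * Units.mk0 (10 : ℚ) (by norm_num) =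
      Units.mk0 ((1024 : ℚ) / 6561) (by norm_num) := Units.ext (by norm_num)
  rw [e]
  exact mem_normUnitsSubgroup_of_sq_add_mul_sq _ (32 / 81 : ℚ) (0 : ℚ) (by norm_num)

/-- **2.A₆ η, second-supply `Σ`-datum `(3_2,5_11,x2_10,x4_11)` with `G`-branch points 5 (genus 517; `Σ = SL2(9):2[phi,h=0]`, `Σ`-datum classes `3_2,5_11,x2_10,x4_11`; `K = ℚ(√-3)`): the absolute value `9/10` of the literal Gram determinant `9/10` of the cup form on `Z/R` ((P1)-model, `K`-dimension 4, `K`-signature (2,2)) has class `[10]` in `ℚˣ/Nm(Kˣ)`** — `(9/10)⁻¹ · 10 = 100/9 = x² + 3·y²` with `x = 10/3`, `y = 0`.  Row **W4.3.10**.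
research route conditional on HC_CM; not a corollary; Q11.4-sentence-2 already refuted in dim ≥ 3. [cite: vanGeemen1994HodgeAV, (5.4.1)] -/
theorem twoA6_eta_sym_3_2_5_11_x2_10_x4_11_b5_gram_mk_eq :
    (QuotientGroup.mk (Units.mk0 ((9 : ℚ) / 10) (by norm_num)) : weilNormResidueGroup 3) =
      QuotientGroup.mk (Units.mk0 (10 : ℚ) (by norm_num)) := by
  rw [QuotientGroup.eq]
  have e : (Units.mk0 ((9 : ℚ) / 10) (by norm_num))⁻¹ * Units.mk0 (10 : ℚ) (by norm_num) =
      Units.mk0 ((100 : ℚ) / 9) (by norm_num) := Units.ext (by norm_num)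
  rw [e]
  exact mem_normUnitsSubgroup_of_sq_add_mul_sq _ (10 / 3 : ℚ) (0 : ℚ) (by norm_num)

/-- **… hence the component carrying `A_t` of this family is NOT the split one: `[9/10] = [10] ≠ splitDiscriminantClass 2 3`** (by the cell's landed non-split certificate for `(ℚ(√-3), a = 10)`, not restated).  Row W4.3.10.
research route conditional on HC_CM; not a corollary; Q11.4-sentence-2 already refuted in dim ≥ 3. [cite: vanGeemen1994HodgeAV, (5.4.1)] -/
theorem twoA6_eta_sym_3_2_5_11_x2_10_x4_11_b5_gram_ne_split :
    (QuotientGroup.mk (Units.mk0 ((9 : ℚ) / 10) (by norm_num)) : weilNormResidueGroup 3) ≠ splitDiscriminantClass 2 3 := by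
  rw [twoA6_eta_sym_3_2_5_11_x2_10_x4_11_b5_gram_mk_eq]
  exact ten_ne_split_three_of_even (by decide)

end Summit.HodgeConjecture.HodgeConjecture.Ring2.WeilCoverage.SigmaDataWeilRowsC

end
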